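import Summits.ABC.StewartYu.PadicTwoFunctions
import Literature.NumberTheory.Transcendental.PadicCW77Series
import HarnessLib

/-!
# Cell abc-stewartyu, W80Two (v): the `2`-adic auxiliary functions as power series —
# coefficients, the weighted bound at radius `4`, jets

`Summits/ABC/StewartYu/PadicTwoSeries.lean` — cell `abc-stewartyu` (seat lit; route
`PadicPrimesW80TwoThirds`, crux `W80Two` stmt-ABC-19486; planner decision D₃), sequel to
`PadicTwoFunctions.lean`.  Plain definitions and theorems; no named fact.  TWIN of
`PadicTwistSeries.lean` (odd `p`, radius `√p`, bound `p^{h Lb}`) for `S : TwoSetup` (`p = 2`,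
generators `≡ 1 (mod 8)`, base `3`): `f_{J,τ}(z) = ∑_u p(u) · Dw₃(z) · qA · exp(expo(u) z)` is a
power series `∑ₙ coeffF n · zⁿ` on `‖z‖ < 4` (`hasSum_coeffF`) with the weighted bound
`‖coeffF n‖ 4ⁿ ≤ 8^{h·Lb}` (`wtBdd_coeffF`: `‖expo‖ ≤ 8⁻¹`, `‖1/j!‖₂ ≤ 2ʲ`, so `‖eC j‖ 4ʲ ≤ 1`; the
`Δ`-polynomial has coefficients in `wDen⁻¹ℤ` with `‖wDen⁻¹‖₂ ≤ 2^{r + l h}` and degree `≤ r + l h`,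
so `‖wC i‖ 4ⁱ ≤ 8^{r + l h} ≤ 8^{h Lb}`), so the small-jets Schwarz lemma
(`PadicNewton.norm_tsum_le_max_of_small_jets`, `ρ = 4`) applies at the integer and third-point
nodes (all of norm `≤ 1`), with jets controlled by values (`norm_jet_F_le`, stated on `‖a‖ ≤ 2`).

## References
* [Yu1990] K. Yu, *Linear forms in p-adic logarithms II*, Compositio Math. 74 (1990), §§1.1, 2–3.
* [CijsouwWaldschmidt1977] P. L. Cijsouw, M. Waldschmidt, Compositio Math. 34 (1977), §4.
-/

noncomputable section

open NormedSpace Finset IsUltrametricDist Polynomial Metric Filter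
open Literature.NumberTheory.Transcendental
open Literature.NumberTheory.Transcendental.Baker1975 (bump bump_apply sum_bump)
open Literature.NumberTheory.Transcendental.Baker1975.Ch3 (wPoly wDen Slot slotVal)
open scoped Nat Topology

namespace Summit.ABC.StewartYu

open Literature.NumberTheory.Transcendental.CW77.Setup (Idx Tau tauNorm bump0 bumpj bumpτ tauNorm_bumpτ)

namespace TwoSetup

variable (S : TwoSetup) {h Lb : ℕ}

/-! ### `2`-adic sizes of factorials and of the denominator `wDen` -/

/-- `‖(n!)⁻¹‖₂ ≤ 2ⁿ` (Legendre: `v₂(n!) ≤ n − 1`). [cite: Yu1990, §1.1] -/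
theorem norm_inv_factorial_le_two_pow (n : ℕ) : ‖((n ! : ℕ) : ℚ_[2])⁻¹‖ ≤ (2 : ℝ) ^ n := by
  have h := PadicExp.norm_inv_natCast_factorial_padic_le (ℓ := 2) n
  push_cast at h
  exact h.trans (pow_le_pow_right₀ (by norm_num) (Nat.sub_le n 1))

/-- `‖wDen(r,l,h)⁻¹‖₂ ≤ 2^{r + l h}`. [cite: Yu1990, Lemma 2.2] -/
theorem norm_inv_wDen_le_two_pow (a b h : ℕ) :
    ‖((wDen a b h : ℕ) : ℚ_[2])⁻¹‖ ≤ (2 : ℝ) ^ (a + b * h) := by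
  unfold wDen
  push_cast
  rw [mul_inv, norm_mul, ← inv_pow, norm_pow, pow_add, pow_mul]
  refine mul_le_mul (norm_inv_factorial_le_two_pow a) ?_ (by positivity) (by positivity)
  rw [← pow_mul, mul_comm b h, pow_mul]
  exact pow_le_pow_left₀ (norm_nonneg _) (norm_inv_factorial_le_two_pow h) b

/-- **`2`-adic size of the coefficients of the `Δ`-polynomial at base `3`**: every coefficient of
`(d/dX)^{τ₀} wOf₃` has norm `≤ 2^{r + l h}` (it lies in `wDen⁻¹ ℤ`).
[cite: CijsouwWaldschmidt1977, §4 Lemma 8 (p. 185)] -/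
theorem norm_coeff_iterate_derivative_wOf₃_le (J₀ J : ℕ) (u : Idx S.d h Lb) (τ₀ i : ℕ) :
    ‖(derivative^[τ₀] (S.wOf₃ J₀ J u)).coeff i‖ ≤ (2 : ℝ) ^ ((u.1.1 : ℕ) + (u.1.2 : ℕ) * h) := by
  obtain ⟨P, hP⟩ :=
    PadicCW77.Setup.exists_int_iterate_derivative_wScaled (3 ^ (J₀ - J)) (u.1.1 : ℕ) (u.1.2 : ℕ) h τ₀
  unfold wOf₃
  rw [iterate_derivative_map, hP, Polynomial.map_mul, Polynomial.map_C, Polynomial.coeff_C_mul,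
    Polynomial.map_map, Polynomial.coeff_map, norm_mul, map_inv₀, map_natCast]
  refine (mul_le_of_le_one_right (norm_nonneg _) ?_).trans (norm_inv_wDen_le_two_pow _ _ _)
  rw [show ((algebraMap ℚ ℚ_[2]).comp (Int.castRingHom ℚ)) (P.coeff i) = ((P.coeff i : ℤ) : ℚ_[2])
    by simp]
  exact Padic.norm_int_le_one _

/-! ### The coefficient sequence of `f_{J,τ}` -/

/-- The coefficients of `exp(expo(u) z)`: `expo(u)^j / j!`. [cite: Yu1990, §1.1] -/
def eC (u : Idx S.d h Lb) (j : ℕ) : ℚ_[2] := S.expo u ^ j / (j ! : ℚ_[2])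

/-- The coefficients of the `Δ`-factor `(d/dX)^{τ₀} wOf₃`. [cite: CijsouwWaldschmidt1977, §4 (p. 186)] -/
def wC₃ (J₀ J : ℕ) (u : Idx S.d h Lb) (τ₀ i : ℕ) : ℚ_[2] := (derivative^[τ₀] (S.wOf₃ J₀ J u)).coeff i

/-- The degree bound used to truncate: `deg (d/dX)^{τ₀} wOf₃`. [cite: Yu1990, Lemma 2.2] -/
def wDeg₃ (J₀ J : ℕ) (u : Idx S.d h Lb) (τ₀ : ℕ) : ℕ := (derivative^[τ₀] (S.wOf₃ J₀ J u)).natDegree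

/-- **The coefficient sequence of `f_{J,τ}`**:
`coeffF n = ∑_u p(u) qA(u,τ') ∑_{i ≤ deg, i ≤ n} wC₃ i · eC (n − i)`. [cite: Yu1990, Lemma 2.2] -/
def coeffF (J₀ J : ℕ) (box : Finset (Idx S.d h Lb)) (pv : Idx S.d h Lb → ℤ) (τ : Tau S.d)
    (n : ℕ) : ℚ_[2] :=
  ∑ u ∈ box, (pv u : ℚ_[2]) * (S.frame.qA u τ.2 : ℚ_[2]) *
    ∑ i ∈ range (S.wDeg₃ J₀ J u τ.1 + 1), if i ≤ n then S.wC₃ J₀ J u τ.1 i * S.eC u (n - i) else 0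

/-! ### Convergence to `f_{J,τ}` on `‖z‖ < 4` -/

/-- `exp(expo(u) z) = ∑ⱼ eC j zʲ` for `‖z‖ < 4`. [cite: Yu1990, §1.1] -/
theorem hasSum_eC (u : Idx S.d h Lb) {z : ℚ_[2]} (hz : ‖z‖ < 4) :
    HasSum (fun j => S.eC u j * z ^ j) (exp (S.expo u * z)) := by
  have hmem := mem_eball_of_norm_lt (S.norm_expo_le u) hz
  rw [smul_eq_mul, mul_comm] at hmem
  have h := expSeries_hasSum_exp_of_mem_ball' (𝕂 := ℚ_[2]) (S.expo u * z) hmem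
  refine h.congr_fun fun j => ?_
  rw [inv_natCast_smul_eq ℚ_[2] ℚ_[2], smul_eq_mul, eC, mul_pow]
  field_simp

/-- `Dw₃(z) = ∑_{i ≤ deg} wC₃ i zⁱ`. [cite: Yu1990, Lemma 2.2] -/
theorem Dw₃_eq_sum (J₀ J : ℕ) (u : Idx S.d h Lb) (τ₀ : ℕ) (z : ℚ_[2]) :
    S.Dw₃ J₀ J u τ₀ z = ∑ i ∈ range (S.wDeg₃ J₀ J u τ₀ + 1), S.wC₃ J₀ J u τ₀ i * z ^ i := by
  unfold Dw₃ wDeg₃ wC₃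
  rw [Polynomial.eval_eq_sum_range]

/-- One shifted series: `∑ₙ [i ≤ n] wC₃ i · eC (n−i) zⁿ = wC₃ i zⁱ · exp(expo z)` (`‖z‖ < 4`).
[cite: Yu1990, Lemma 2.2] -/
theorem hasSum_shift (J₀ J : ℕ) (u : Idx S.d h Lb) (τ₀ i : ℕ) {z : ℚ_[2]} (hz : ‖z‖ < 4) :
    HasSum (fun n => (if i ≤ n then S.wC₃ J₀ J u τ₀ i * S.eC u (n - i) else 0) * z ^ n)
      (S.wC₃ J₀ J u τ₀ i * z ^ i * exp (S.expo u * z)) := by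
  have h := (S.hasSum_eC u hz).mul_left (S.wC₃ J₀ J u τ₀ i * z ^ i)
  rw [← hasSum_nat_add_iff' i]
  have h0 : ∑ n ∈ range i, (if i ≤ n then S.wC₃ J₀ J u τ₀ i * S.eC u (n - i) else 0) * z ^ n = 0 :=
    sum_eq_zero fun n hn => by rw [if_neg (by have := mem_range.mp hn; omega), zero_mul]
  rw [h0, sub_zero]
  refine h.congr_fun fun n => ?_
  rw [if_pos (by omega), Nat.add_sub_cancel, pow_add]
  ring

/-- One term: `∑ₙ (∑ᵢ [i ≤ n] wC₃ i eC (n−i)) zⁿ = Dw₃(z) · exp(expo z)` (`‖z‖ < 4`).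
[cite: Yu1990, Lemma 2.2] -/
theorem hasSum_term (J₀ J : ℕ) (u : Idx S.d h Lb) (τ : Tau S.d) {z : ℚ_[2]} (hz : ‖z‖ < 4) :
    HasSum (fun n => (∑ i ∈ range (S.wDeg₃ J₀ J u τ.1 + 1),
        (if i ≤ n then S.wC₃ J₀ J u τ.1 i * S.eC u (n - i) else 0)) * z ^ n)
      (S.Dw₃ J₀ J u τ.1 z * exp (S.expo u * z)) := by
  have h := hasSum_sum fun i (_ : i ∈ range (S.wDeg₃ J₀ J u τ.1 + 1)) => S.hasSum_shift J₀ J u τ.1 i hz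
  rw [S.Dw₃_eq_sum, sum_mul]
  refine h.congr_fun fun n => ?_
  rw [sum_mul]

/-- **`f_{J,τ}(z) = ∑ₙ coeffF n zⁿ` on `‖z‖ < 4`.** [cite: Yu1990, Lemma 2.2] -/
theorem hasSum_coeffF (J₀ J : ℕ) (box : Finset (Idx S.d h Lb)) (pv : Idx S.d h Lb → ℤ)
    (τ : Tau S.d) {z : ℚ_[2]} (hz : ‖z‖ < 4) :
    HasSum (fun n => S.coeffF J₀ J box pv τ n * z ^ n) (S.F J₀ J box pv τ z) := by
  unfold F coeffF
  have h := hasSum_sum fun u (_ : u ∈ box) =>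
    (S.hasSum_term J₀ J u τ hz).mul_left ((pv u : ℚ_[2]) * (S.frame.qA u τ.2 : ℚ_[2]))
  have e : ∑ u ∈ box, (pv u : ℚ_[2]) * (S.frame.qA u τ.2 : ℚ_[2]) *
      (S.Dw₃ J₀ J u τ.1 z * exp (S.expo u * z)) = ∑ u ∈ box, (pv u : ℚ_[2]) * S.termF J₀ J u τ z :=
    sum_congr rfl fun u _ => by simp only [termF]; ring
  rw [← e]
  refine h.congr_fun fun n => ?_
  rw [sum_mul]
  exact sum_congr rfl fun u _ => by ring

/-- `f_{J,τ}(z) = ∑' coeffF n zⁿ` on `‖z‖ < 4`. [cite: Yu1990, Lemma 2.2] -/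
theorem F_eq_tsum (J₀ J : ℕ) (box : Finset (Idx S.d h Lb)) (pv : Idx S.d h Lb → ℤ) (τ : Tau S.d)
    {z : ℚ_[2]} (hz : ‖z‖ < 4) :
    S.F J₀ J box pv τ z = ∑' n, S.coeffF J₀ J box pv τ n * z ^ n :=
  (S.hasSum_coeffF J₀ J box pv τ hz).tsum_eq.symm

/-- `f_{J,τ}` agrees with its power series near every point of `‖z‖ < 4`. [cite: Yu1990, Lemma 2.2] -/
theorem F_eventuallyEq_tsum (J₀ J : ℕ) (box : Finset (Idx S.d h Lb)) (pv : Idx S.d h Lb → ℤ)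
    (τ : Tau S.d) {a : ℚ_[2]} (ha : ‖a‖ < 4) :
    S.F J₀ J box pv τ =ᶠ[𝓝 a] fun z => ∑' n, S.coeffF J₀ J box pv τ n * z ^ n := by
  have hball : {z : ℚ_[2] | ‖z‖ < 4} ∈ 𝓝 a := by
    have : {z : ℚ_[2] | ‖z‖ < 4} = Metric.ball 0 4 := by
      ext z; simp
    rw [this]
    exact Metric.isOpen_ball.mem_nhds (by simpa using ha)
  filter_upwards [hball] with z hz using S.F_eq_tsum J₀ J box pv τ hz

/-! ### The weighted bound `‖coeffF n‖ 4ⁿ ≤ 8^{h Lb}` -/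

/-- `‖eC j‖ 4ʲ ≤ 1` (`‖expo‖ ≤ 8⁻¹`, `‖1/j!‖₂ ≤ 2ʲ`). [cite: Yu1990, §1.1] -/
theorem norm_eC_mul_le (u : Idx S.d h Lb) (j : ℕ) : ‖S.eC u j‖ * 4 ^ j ≤ 1 := by
  unfold eC
  rw [div_eq_mul_inv, norm_mul, norm_pow, show ((j ! : ℚ_[2])) = ((j ! : ℕ) : ℚ_[2]) by norm_cast]
  have h1 : ‖S.expo u‖ ^ j ≤ ((8 : ℝ)⁻¹) ^ j :=
    pow_le_pow_left₀ (norm_nonneg _) (S.norm_expo_le u) j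
  have h2 := norm_inv_factorial_le_two_pow j
  calc ‖S.expo u‖ ^ j * ‖((j ! : ℕ) : ℚ_[2])⁻¹‖ * 4 ^ j
      ≤ ((8 : ℝ)⁻¹) ^ j * (2 : ℝ) ^ j * 4 ^ j := by
        refine mul_le_mul_of_nonneg_right (mul_le_mul h1 h2 (norm_nonneg _) (by positivity)) ?_
        positivity
    _ = 1 := by rw [← mul_pow, ← mul_pow]; norm_num

/-- `‖wC₃ i‖ 4ⁱ ≤ 8^{h Lb}` — precisely `≤ 2^{deg w} 4^{deg w}` with `deg w = r + l h < h Lb`;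
coefficients beyond the degree vanish. [cite: CijsouwWaldschmidt1977, §4 Lemma 8 (p. 185)] -/
theorem norm_wC_mul_le (J₀ J : ℕ) (u : Idx S.d h Lb) (τ₀ i : ℕ) :
    ‖S.wC₃ J₀ J u τ₀ i‖ * 4 ^ i ≤ (8 : ℝ) ^ (h * Lb) := by
  set N := (u.1.1 : ℕ) + (u.1.2 : ℕ) * h with hN
  -- degree bound
  have hdeg : (derivative^[τ₀] (S.wOf₃ J₀ J u)).natDegree ≤ N := by
    refine (natDegree_iterate_derivative _ _).trans ((Nat.sub_le _ _).trans ?_)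
    unfold wOf₃
    refine (natDegree_map_le).trans ?_
    rw [Waldschmidt1980.natDegree_wScaled (pow_ne_zero _ three_ne_zero)]
  have hNle : N ≤ h * Lb := by
    have hr : (u.1.1 : ℕ) < h := u.1.1.isLt
    have hl : (u.1.2 : ℕ) + 1 ≤ Lb := u.1.2.isLt
    have : N < h * Lb := by
      calc N = (u.1.1 : ℕ) + (u.1.2 : ℕ) * h := rfl
        _ < h + (u.1.2 : ℕ) * h := by omega
        _ = ((u.1.2 : ℕ) + 1) * h := by ring
        _ ≤ Lb * h := Nat.mul_le_mul_right _ hl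
        _ = h * Lb := mul_comm _ _
    omega
  by_cases hi : i ≤ N
  · unfold wC₃
    calc ‖(derivative^[τ₀] (S.wOf₃ J₀ J u)).coeff i‖ * 4 ^ i
        ≤ (2 : ℝ) ^ N * 4 ^ N :=
          mul_le_mul (S.norm_coeff_iterate_derivative_wOf₃_le J₀ J u τ₀ i)
            (pow_le_pow_right₀ (by norm_num) hi) (by positivity) (by positivity)
      _ = (8 : ℝ) ^ N := by rw [← mul_pow]; norm_num
      _ ≤ (8 : ℝ) ^ (h * Lb) := pow_le_pow_right₀ (by norm_num) hNle
  · have h0 : S.wC₃ J₀ J u τ₀ i = 0 := by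
      unfold wC₃
      exact coeff_eq_zero_of_natDegree_lt (by omega)
    rw [h0, norm_zero, zero_mul]; positivity

/-- **The weighted coefficient bound**: `WtBdd 4 (8^{h Lb}) coeffF` — `‖coeffF n‖ 4ⁿ ≤ 8^{h Lb}`
(ultrametric: each `p(u) ∈ ℤ`, `‖qA‖ ≤ 1`, `‖wC₃ i‖ 4ⁱ ≤ 8^{hLb}`, `‖eC j‖ 4ʲ ≤ 1`).
[cite: Yu1990, Lemma 2.2] -/
theorem wtBdd_coeffF (J₀ J : ℕ) (box : Finset (Idx S.d h Lb)) (pv : Idx S.d h Lb → ℤ)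
    (τ : Tau S.d) :
    PadicNewton.WtBdd 4 ((8 : ℝ) ^ (h * Lb)) (S.coeffF J₀ J box pv τ) := by
  intro n
  have hsp : (0 : ℝ) < 4 ^ n := pow_pos (by norm_num) n
  rw [← le_div_iff₀ hsp]
  have hB : 0 ≤ (8 : ℝ) ^ (h * Lb) / 4 ^ n := by positivity
  unfold coeffF
  refine norm_sum_le_of_forall_le_of_nonneg hB fun u _ => ?_
  rw [norm_mul, norm_mul]
  refine (mul_le_of_le_one_left (norm_nonneg _)
    (mul_le_one₀ (Padic.norm_int_le_one _) (norm_nonneg _) (S.norm_qA_le u τ.2))).trans ?_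
  refine norm_sum_le_of_forall_le_of_nonneg hB fun i _ => ?_
  split_ifs with hin
  · rw [le_div_iff₀ hsp, norm_mul]
    have e : (4 : ℝ) ^ n = 4 ^ i * 4 ^ (n - i) := by
      rw [← pow_add, Nat.add_sub_cancel' hin]
    rw [e]
    calc ‖S.wC₃ J₀ J u τ.1 i‖ * ‖S.eC u (n - i)‖ * ((4 : ℝ) ^ i * 4 ^ (n - i))
        = (‖S.wC₃ J₀ J u τ.1 i‖ * 4 ^ i) * (‖S.eC u (n - i)‖ * 4 ^ (n - i)) := by ring
      _ ≤ (8 : ℝ) ^ (h * Lb) * 1 :=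
          mul_le_mul (S.norm_wC_mul_le J₀ J u τ.1 i) (S.norm_eC_mul_le u (n - i)) (by positivity)
            (by positivity)
      _ = (8 : ℝ) ^ (h * Lb) := mul_one _
  · rw [norm_zero]; exact hB

/-! ### Jets of `f_{J,τ}` from the values of the `f_{J,τ'}` -/

/-- **The jets of `f_{J,τ}` at a node are controlled by the values of the `f_{J,τ'}` there**:
if `‖f_{J,τ'}(a)‖ ≤ ε` for all `|τ'| ≤ N` (`‖a‖ ≤ 2`; the integer nodes `s` and the third points
`s/3` all have norm `≤ 1`), then for `|τ| + k ≤ N` the `k`-th jet of the power series of `f_{J,τ}`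
at `a` has norm `≤ ‖(k!)⁻¹‖₂ · ε`.  This is the hypothesis `hjet` of
`PadicNewton.norm_tsum_le_max_of_small_jets` (radius `ρ = 4`, any `r ≤ 2`).
[cite: Yu1990, Lemma 2.4] [cite: CijsouwWaldschmidt1977, §4 (11) (p. 189)] -/
theorem norm_jet_F_le (J₀ J : ℕ) (box : Finset (Idx S.d h Lb)) (pv : Idx S.d h Lb → ℤ)
    {a : ℚ_[2]} (ha : ‖a‖ ≤ 2) (N : ℕ) {ε : ℝ} (hε0 : 0 ≤ ε)
    (hε : ∀ τ : Tau S.d, tauNorm τ ≤ N → ‖S.F J₀ J box pv τ a‖ ≤ ε)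
    (k : ℕ) (τ : Tau S.d) (hk : tauNorm τ + k ≤ N) :
    ‖PadicNewton.jet a (S.coeffF J₀ J box pv τ) k‖ ≤ ‖((k ! : ℕ) : ℚ_[2])⁻¹‖ * ε := by
  have ha' : ‖a‖ < 4 := lt_of_le_of_lt ha (by norm_num)
  have hb := S.wtBdd_coeffF J₀ J box pv τ
  have hj := PadicNewton.norm_jet_le_norm_iteratedDeriv (by norm_num : (0 : ℝ) < 4)
    (by norm_num : (2 : ℝ) < 4) two_pos hb ha k
  refine hj.trans (mul_le_mul_of_nonneg_left ?_ (norm_nonneg _))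
  rw [← (S.F_eventuallyEq_tsum J₀ J box pv τ ha').iteratedDeriv_eq k]
  exact S.norm_iteratedDeriv_F_le_of_forall J₀ J box pv ha' N hε0 hε k τ hk

end TwoSetup

end Summit.ABC.StewartYu

end
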